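import Summits.QuantumFields.BalabanUV.T4Continuum.Support.NE9HoloFamilyCoupledEnd
import Summits.QuantumFields.BalabanUV.T4Continuum.Support.NE9HoloFamilyPotentialKPG
import Summits.QuantumFields.BalabanUV.T4Continuum.Support.NE9VacuumSubtractedBridgeFloor

/-!
# NE9HoloFamilyCoupledEndSharp2 — route R4♯'s END at the record with BOTH halves in letters, the table half on `PotentialKPG`
# (KP for m) and the coupling half at leaf-06's constant-1 majorant bound: ℓ = 2·clipbar·B + 2·B∕(R₀ − s₀)·qTbar (E131: 8·clipbar·B + …)

Cell `pub-balaban`, T4-DAG §6 NE9; BINDER row NE9 OWNER lineage `b2b-balaban-t4-ne9-p1` gen 61, CRUX PROVER NE9 (ruling e34b3e0c (2));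
route R4 ∕ R4♯ of `t4/ROUTES-NE9.md` v8 (rank 1).  The owner's follow-up to leaf lineage `…-leaf-06` gen 39's INTENT 5 (D1
`NE9MajorantLipschitzSharp` = the pinned common-majorant Lipschitz bound at constant `clip` instead of `4·clip`; D2 `NE9VacuumSubtractedBridgeFloor`
§2 `lastCouplingLipschitz_of_couplingTwoPoint_vacSub_sharp2` = the binder (L) at `2·clip k·B₀ k + 2·B₀ k∕(R₀ − s₀)·qT k`, binder list VERBATIM
= p256991 §1's): E131's §3–§5 (`NE9HoloFamilyCoupledEnd`) RE-DOCKED by the ONE name swap `…_vacSub_sharp ↦ …_vacSub_sharp2`, and at the same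
time moved onto E132's table-half letter `hKP : PotentialKPG W act m a d R₀` (`NE9HoloFamilyPotentialKPG`): §1 (L) on route R4 from the
coupling two-point letters with NO occupation hypothesis (F-g61-1) at the coupling constant `2·clip`; §2 the ♯-END with `ℓ = 2·clipbar·B +
2·B∕(R₀ − s₀)·qTbar` at rate `θ`; §3 at `Ψ := ΨOf`.  KP for `2m` (`hkp2`) REMAINS — it is `TwoPointKP`'s own clause, the activity-space
room the coupling half's Cauchy disc uses (on BOTH co-leads); the inner radius `s₀ < R₀` remains for the coupling half's stadium part.
So after this file the two co-leads' record ENDs agree on the pencil letter `PotentialKPG`, on the coupling data (`hCup`, `hTcup`)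
and on ℓ's summands (`2·clipbar·B`, `2·B·qTbar∕(R₀ − s₀)`); KP for 2m rides as `hkp2` here and inside `hK : TwoPointKP` (with its own
majorant `n`) on R3′; they differ by occupation ∕ size induction + N2 (R3′) vs `hexplZ`∕p̄₀ + ROOM (R4) and by the rate
(`ω + 2Bτ̄∕(R₀−s₀)` vs `θ`).
HONEST FRAMING (T4-DAG PAGE 1).  Rung (B)+1 of the FINITE-VOLUME T⁴ programme — NOT infinite volume, NOT a mass gap, NOT Clay.  NE9
(`T4OutputRate.NE9` ∧ `FadingMemory`) is a cell NEW ESTIMATE, NOT PRINTED in [I] = [Balaban1987RG1] (CMP **109**), [II] =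
[Balaban1988RG2Cluster] (CMP **116**), NOT PROVED for Bałaban's E^{(j)}: every theorem below is «NE9 ⇐ the named binders»; displayed
Bałaban-side inputs: `PotentialKPG` on `R₀` at every background incl. `U₀` ((R-0)[scope], typed as `NE9PencilScope238.PencilScope238`),
`hkp2`, `hdec`, `hpin`, the COUPLING TWO-POINT `hCup` (NOT PRINTED as an inequality) + `hTcup` (TYPE [II] (1.33)–(1.36)), `hexplZ` (TYPE [I]
(2.14) ∕ [II] (2.41)), structural binders, ROOM; W1 = model O-NE9-1 untouched; spine 0∕9.  HONEST DEPENDENCY (cell line, verbatim):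
continuum YM on T⁴ ⇐ BetaPertH ∧ nine spine estimates (0/9 proved); BetaPertH ⇐ (D1) ∧ (D4) ∧ CAP+tail; G-an2-4 gates asym, D1 and NE2/3/4.
`FlowStep.BetaPertH`, (B), (B^μ) do not occur; [I]∕[II] for TYPES only (ABSOLUTE RULE).  0 def, 0 sorry.  A smaller modulus letter inside a
CONDITIONAL END is not progress on the estimate itself (refuter v9∕v10: rate-inert, cell-neutral).  References (TYPES only):
[Balaban1987RG1] CMP **109** (2.13)–(2.14) p. 268, p. 263; [Balaban1988RG2Cluster] CMP **116** (1.33)–(1.36) p. 9, (2.14)–(2.15) p. 15,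
(2.38) p. 20, (2.40)–(2.41) p. 21; [FV1980] ch. V §5.  Summits-side NEW work (LEAN PLACEMENT RULE); imports E131, E132 and leaf-06's D2 BY
NAME; modifies nothing.  Value = literal letter parity of the two co-leads' record ENDs on the coupling summand, NOT summit progress.
-/

noncomputable section

namespace Summit.QuantumFields.BalabanUV.T4Continuum.NE9HoloFamilyCoupledEndSharp2

open Metric Set ComplexConjugate
open scoped BigOperators ENNReal
open Literature.Probability.LatticeModels
open Literature.MathematicalPhysics.QuantumFieldTheory.Balaban1983to89
open Literature.MathematicalPhysics.QuantumFieldTheory.Balaban1983to89.T4OutputRate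
open Literature.MathematicalPhysics.QuantumFieldTheory.Balaban1983to89.T4ActivityLipschitz
open Literature.MathematicalPhysics.QuantumFieldTheory.Balaban1983to89.T4HistoryLipschitzRecursion
open Literature.MathematicalPhysics.QuantumFieldTheory.Balaban1983to89.T4HistoryLipschitzOuter
open Literature.MathematicalPhysics.QuantumFieldTheory.Balaban1983to89.T4HistoryLipschitzActivity
open Literature.MathematicalPhysics.QuantumFieldTheory.Balaban1983to89.T4HistoryLipschitzSegment
open Literature.MathematicalPhysics.QuantumFieldTheory.Balaban1983to89.T4HistoryLipschitzActivity (ClusterGeom)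
open Summit.QuantumFields.BalabanUV.T4Continuum.NE9EarleHamiltonChain Summit.QuantumFields.BalabanUV.T4Continuum.NE9FutureProfileStep
open Summit.QuantumFields.BalabanUV.T4Continuum.NE9FutureProfileEnd
open Summit.QuantumFields.BalabanUV.T4Continuum.NE9ChannelRealLinear
open Summit.QuantumFields.BalabanUV.T4Continuum.NE9SliceSpaceOfRecord
open Summit.QuantumFields.BalabanUV.T4Continuum.NE9ChannelReadingOfRecord
open Summit.QuantumFields.BalabanUV.T4Continuum.NE9ChannelReadingSharp
open Summit.QuantumFields.BalabanUV.T4Continuum.NE9TableReading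
open Summit.QuantumFields.BalabanUV.T4Continuum.NE9FutureProfileRecordPrelim
open Summit.QuantumFields.BalabanUV.T4Continuum.NE9FutureProfileEndOfRecordSharp
open Summit.QuantumFields.BalabanUV.T4Continuum.NE9FutureProfileEndOfRecordSP
open Summit.QuantumFields.BalabanUV.T4Continuum.NE9TwoPointKPOfPencil Summit.QuantumFields.BalabanUV.T4Continuum.NE9HoloSliceOfFamily
open Summit.QuantumFields.BalabanUV.T4Continuum.NE9HoloFamilyOfPencil Summit.QuantumFields.BalabanUV.T4Continuum.NE9FutureProfileReal
open Summit.QuantumFields.BalabanUV.T4Continuum.NE9HoloFamilyVacuumSubtracted (psiOf_eq_vac)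
open Summit.QuantumFields.BalabanUV.T4Continuum.NE9HoloFamilyCoupledEnd (termSize_and_occupation_of_room)
open Summit.QuantumFields.BalabanUV.T4Continuum.NE9HoloFamilyPotentialKPG (vacSlice_clauses_of_potentialKPG)
open Summit.QuantumFields.BalabanUV.T4Continuum.NE9VacuumSubtractedBridgeFloor (lastCouplingLipschitz_of_couplingTwoPoint_vacSub_sharp2)

variable {C : Carriers} (G : ClusterGeom C) {Bg : Type}

section Room

variable {ι : Type} [Nonempty ι] {E : Functional C Bg} {W : Set (ℕ → ℝ)} {Adm : Set (Bg → C.Dom → ℝ)}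
  {T : ℕ → (ℕ → ℝ) → (Bg → C.Dom → ℝ) → ι → ℝ} {Ψ : ℕ → ℝ → (ι → ℝ) → Bg → C.Dom → ℝ}
  {κ : ℝ} {wt : ℕ → ι → ℝ} {τ : ℕ → ℕ → ℝ} {τbar ω ωh : ℝ}

/-! ## §1 The coupling half (L) on route R4 at the constant-1 majorant bound, table half on `PotentialKPG` -/

/-- **`LastCouplingLipschitz` ON ROUTE R4 FROM COUPLING TWO-POINT DATA AT `2·clip` — NO OCCUPATION HYPOTHESIS, NO SIZE INDUCTION.**
Displayed inputs: structural binders; the pencil as `hKP : PotentialKPG W act m a d R₀` (every background incl. `U₀`) + KP for `2m` (`hkp2`,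
`TwoPointKP`'s own clause) + `hdec` + `hpin` (budget `B`); the record's shape `hΨv` + `hexplZ`∕`hp₀`; the COUPLING TWO-POINT `hCup` on
`ball 0 s₀` with the pencil's majorant at the second coupling, `clip k ≥ 0`; the channel's coupling modulus `hTcup`, `qT k ≥ 0`; the ROOM
`ω̂·s₀ + τ̄·(2B + p̄₀) ≤ θ·s₀`, `0 < s₀ < R₀`, `θ < 1`.  Conclusion: `LastCouplingLipschitz E W T Ψ κ (fun k => 2·clip k·B + 2·B∕(R₀ − s₀)·qT k)`.
Proof: leaf-06's `NE9VacuumSubtractedBridgeFloor.lastCouplingLipschitz_of_couplingTwoPoint_vacSub_sharp2` at `𝒜 k := ball 0 s₀`, `ρ k := reading (wt k)`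
(`hρ` := `norm_reading_sub_le`), `TwoPointKP` := `twoPointKP_of_potentialKPG`, occupation := E131's `termSize_and_occupation_of_room` on E132's slice
clauses restricted to `ball 0 s₀` (σ := `star`).
[cite: Balaban1987RG1, p.263 (1.18) and (2.13)-(2.14) p.268; Balaban1988RG2Cluster, (1.36) p.9, (2.14)-(2.15) p.15, (2.38) p.20, (2.40)-(2.41) p.21] -/
theorem lastCouplingLipschitz_of_couplingTwoPoint_room_sharp2
    (h0 : ∀ g ∈ W, ∀ (U : Bg) (X : C.Dom), C.scale X = 0 → E g U X = 0)
    (hAdm : AdmissibleTerms E W Adm) (hres : AdmRestrict Adm) (hadd : ChannelAdditive Adm T) (hloc : ChannelLocal Adm T)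
    (hstep : ChannelSizeAtStepNN Adm T κ wt τ) (hfac : Factorises E W T Ψ)
    (hsmul : ∀ (c : ℝ), ∀ H ∈ Adm, c • H ∈ Adm) (hne : Adm.Nonempty) (hwt : ∀ m y, 0 < wt m y)
    (hτ : ∀ k j, j ≤ k → 0 ≤ τ k j ∧ τ k j ≤ τbar * ω ^ (k - j)) (hτbar : 0 < τbar) (hω : 0 ≤ ω) (hωh : 0 < ωh)
    (hωωh : ω ≤ ωh)
    {act : ℕ → ℝ → Bg → lp (fun _ : ι => ℂ) ∞ → G.P → ℂ} {m : ℕ → ℝ → Bg → G.P → ℝ} {a d : G.P → ℝ}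
    {δ : C.Dom → ℝ} {U₀ : Bg} {explZ : ℕ → Bg → C.Dom → ℝ} {p₀ clip qT : ℕ → ℝ} {R₀ s₀ B pbar θ : ℝ}
    (hs₀ : 0 < s₀) (hsR : s₀ < R₀) (hB : 0 ≤ B) (hpbar : 0 ≤ pbar) (hθ1 : θ < 1)
    (hKP : G.PotentialKPG W act m a d R₀)
    (hkp2 : ∀ g ∈ W, ∀ (k : ℕ) (U : Bg) (X : C.Dom), C.scale X = k + 1 →
      ∀ γ ∈ G.vol X, ∑ γ' ∈ G.vol X with G.inc γ' γ, 2 * m k (g k) U γ' * Real.exp (a γ' + d γ') ≤ a γ)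
    (hdec : G.DecayExtract δ d) (hpin : G.PinBudget a δ (fun _ => B) κ)
    (hΨv : ∀ (k : ℕ) (s : ℝ) (P : ι → ℝ) (U : Bg) (X : C.Dom),
      Ψ k s P U X = (G.newTerm act k s U X (reading (wt k) P)).re - (G.newTerm act k s U₀ X (reading (wt k) P)).re +
        explZ k U X)
    (hexplZ : ∀ (k : ℕ) (U : Bg) (X : C.Dom), C.scale X = k + 1 → |explZ k U X| ≤ Real.exp (-(κ * C.d X)) * p₀ k)
    (hp₀ : ∀ k, p₀ k ≤ pbar) (hclip0 : ∀ k, 0 ≤ clip k)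
    (hCup : ∀ g ∈ W, ∀ g' ∈ W, ∀ (k : ℕ) (U : Bg) (X : C.Dom), C.scale X = k + 1 →
      ∀ Q ∈ ball (0 : lp (fun _ : ι => ℂ) ∞) s₀, ∀ γ ∈ G.vol X,
        ‖act k (g k) U Q γ‖ ≤ m k (g' k) U γ ∧
          ‖act k (g k) U Q γ - act k (g' k) U Q γ‖ ≤ clip k * |g k - g' k| * m k (g' k) U γ)
    (hqT0 : ∀ k, 0 ≤ qT k)
    (hTcup : ∀ g ∈ W, ∀ g' ∈ W, ∀ (k : ℕ) (y : ι), |T k g (E g) y - T k g' (E g) y| ≤ wt k y * (qT k * |g k - g' k|))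
    (hroom : ωh * s₀ + τbar * (2 * B + pbar) ≤ θ * s₀) :
    LastCouplingLipschitz E W T Ψ κ (fun k => 2 * clip k * B + 2 * B / (R₀ - s₀) * qT k) := by
  obtain ⟨σ, hσa, hσ, hiso⟩ := exists_star_clm_lp (ι := ι)
  have hfixρ : ∀ (k : ℕ) (P : ι → ℝ), σ (reading (wt k) P) = reading (wt k) P := fun k P => by
    rw [hσa]; exact (isSelfAdjoint_reading (wt k) P).star_eq
  obtain ⟨-, hΦbR, hrealR⟩ := vacSlice_clauses_of_potentialKPG (W := W) (E := E) (T := T) (Ψ := Ψ) (κ := κ) G hσ hiso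
    hfixρ hB hpbar hKP hdec hpin hΨv hexplZ hp₀
  have hss : ball (0 : lp (fun _ : ι => ℂ) ∞) s₀ ⊆ ball 0 R₀ := ball_subset_ball hsR.le
  -- occupation of the record's tables in `ball 0 s₀`, from the ROOM (E131 §1 on E132's slice clauses restricted to the inner ball)
  obtain ⟨-, hocc⟩ := termSize_and_occupation_of_room h0 hAdm hres hadd hloc hstep hfac hsmul hne hwt hτ hω hωh hωωh
    hτbar.le (fun j n s _ => norm_RdAmb_le_geometric_sharp (τ_geom hτ) j n s) hs₀ (by positivity) hθ1
    (fun k g hg => (hΦbR k g hg).mono hss Subset.rfl)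
    (fun k g hg s hs hmem => hrealR k g hg s hs (hss hmem)) hroom
  have h𝒜 : ∀ k : ℕ, (fun _ : ℕ => ball (0 : lp (fun _ : ι => ℂ) ∞) s₀) k ⊆ closedBall 0 s₀ := fun _ => ball_subset_closedBall
  have hK := twoPointKP_of_potentialKPG G (𝒜 := fun _ => ball (0 : lp (fun _ : ι => ℂ) ∞) s₀) hKP hsR h𝒜 hkp2
  exact lastCouplingLipschitz_of_couplingTwoPoint_vacSub_sharp2 G (fun k => reading (wt k)) U₀ explZ hK hKP hsR h𝒜 hclip0 hCup
    hdec hpin (fun k P P' M h => norm_reading_sub_le (hwt k) h) hΨv hqT0 hTcup (fun g hg g' hg' k => hocc g hg g' hg' k)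

/-! ## §2 THE ♯-END OF RECORD, both halves in letters, ℓ = 2·clipbar·B + 2·B∕(R₀ − s₀)·qTbar -/

/-- **ROUTE R4♯'s END OF RECORD ON THE RECORD's NEW-TERM SHAPE, TABLE HALF ON `PotentialKPG`, COUPLING HALF AT `2·clip`.**
Hypotheses: structural binders; `hKP` + `hkp2` + `hdec` + `hpin`; `hΨv`; `hexplZ`∕`hp₀`; the coupling two-point `hCup` (on `ball 0 s₀`),
`hclip0`∕`hclipb`; the channel's coupling modulus `hTcup`, `hqT0`∕`hqTb`; the ROOM `ω̂·s₀ + τ̄·(2B + p̄₀) ≤ θ·s₀`, `0 < s₀ < R₀`, `0 < θ < 1`.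
NO occupation hypothesis, NO size induction, NO `hρ`, NO `hhol`∕`hsup`.  Conclusion: `NE9 E W κ (prodModuli ((1∕(1−θ²))·ℓ) (fun _ => θ)) ∧
FadingMemory …`, `ℓ = 2·clipbar·B + 2·B∕(R₀ − s₀)·qTbar` (E131: `8·clipbar·B + …`).  Proof: §1 ⊕ E132's slice clauses on the inner ball ⊕
leaf-05's `ne9_and_fadingMemory_of_holoSlice_sharp_SP`.  «NE9 ⇐ the named binders».
[cite: Balaban1987RG1, (2.13)-(2.14) p.268 and p.263; Balaban1988RG2Cluster, (1.33)-(1.36) p.9, (2.14)-(2.15) p.15, (2.38) p.20, (2.40)-(2.41) p.21; FV1980, ch.V §5] -/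
theorem ne9_and_fadingMemory_of_potentialKPG_coupling_SP_vac
    (h0 : ∀ g ∈ W, ∀ (U : Bg) (X : C.Dom), C.scale X = 0 → E g U X = 0)
    (hAdm : AdmissibleTerms E W Adm) (hres : AdmRestrict Adm) (hadd : ChannelAdditive Adm T) (hloc : ChannelLocal Adm T)
    (hstep : ChannelSizeAtStepNN Adm T κ wt τ) (hfac : Factorises E W T Ψ)
    (hsmul : ∀ (c : ℝ), ∀ H ∈ Adm, c • H ∈ Adm) (hne : Adm.Nonempty) (hwt : ∀ m y, 0 < wt m y)
    (hτ : ∀ k j, j ≤ k → 0 ≤ τ k j ∧ τ k j ≤ τbar * ω ^ (k - j)) (hτbar : 0 < τbar) (hω : 0 ≤ ω) (hωh : 0 < ωh)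
    (hωωh : ω ≤ ωh)
    {act : ℕ → ℝ → Bg → lp (fun _ : ι => ℂ) ∞ → G.P → ℂ} {m : ℕ → ℝ → Bg → G.P → ℝ} {a d : G.P → ℝ}
    {δ : C.Dom → ℝ} {U₀ : Bg} {explZ : ℕ → Bg → C.Dom → ℝ} {p₀ clip qT : ℕ → ℝ} {R₀ s₀ B pbar θ clipbar qTbar : ℝ}
    (hs₀ : 0 < s₀) (hsR : s₀ < R₀) (hB : 0 ≤ B) (hpbar : 0 ≤ pbar) (hθ0 : 0 < θ) (hθ1 : θ < 1)
    (hKP : G.PotentialKPG W act m a d R₀)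
    (hkp2 : ∀ g ∈ W, ∀ (k : ℕ) (U : Bg) (X : C.Dom), C.scale X = k + 1 →
      ∀ γ ∈ G.vol X, ∑ γ' ∈ G.vol X with G.inc γ' γ, 2 * m k (g k) U γ' * Real.exp (a γ' + d γ') ≤ a γ)
    (hdec : G.DecayExtract δ d) (hpin : G.PinBudget a δ (fun _ => B) κ)
    (hΨv : ∀ (k : ℕ) (s : ℝ) (P : ι → ℝ) (U : Bg) (X : C.Dom),
      Ψ k s P U X = (G.newTerm act k s U X (reading (wt k) P)).re - (G.newTerm act k s U₀ X (reading (wt k) P)).re +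
        explZ k U X)
    (hexplZ : ∀ (k : ℕ) (U : Bg) (X : C.Dom), C.scale X = k + 1 → |explZ k U X| ≤ Real.exp (-(κ * C.d X)) * p₀ k)
    (hp₀ : ∀ k, p₀ k ≤ pbar) (hclip0 : ∀ k, 0 ≤ clip k) (hclipb : ∀ k, clip k ≤ clipbar)
    (hCup : ∀ g ∈ W, ∀ g' ∈ W, ∀ (k : ℕ) (U : Bg) (X : C.Dom), C.scale X = k + 1 →
      ∀ Q ∈ ball (0 : lp (fun _ : ι => ℂ) ∞) s₀, ∀ γ ∈ G.vol X,
        ‖act k (g k) U Q γ‖ ≤ m k (g' k) U γ ∧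
          ‖act k (g k) U Q γ - act k (g' k) U Q γ‖ ≤ clip k * |g k - g' k| * m k (g' k) U γ)
    (hqT0 : ∀ k, 0 ≤ qT k) (hqTb : ∀ k, qT k ≤ qTbar)
    (hTcup : ∀ g ∈ W, ∀ g' ∈ W, ∀ (k : ℕ) (y : ι), |T k g (E g) y - T k g' (E g) y| ≤ wt k y * (qT k * |g k - g' k|))
    (hroom : ωh * s₀ + τbar * (2 * B + pbar) ≤ θ * s₀) :
    NE9 E W κ (prodModuli (1 / (1 - θ ^ 2) * (2 * clipbar * B + 2 * B / (R₀ - s₀) * qTbar)) fun _ => θ) ∧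
      FadingMemory (1 / (1 - θ ^ 2) * (2 * clipbar * B + 2 * B / (R₀ - s₀) * qTbar) / θ) θ
        (prodModuli (1 / (1 - θ ^ 2) * (2 * clipbar * B + 2 * B / (R₀ - s₀) * qTbar)) fun _ => θ) := by
  obtain ⟨σ, hσa, hσ, hiso⟩ := exists_star_clm_lp (ι := ι)
  have hfixρ : ∀ (k : ℕ) (P : ι → ℝ), σ (reading (wt k) P) = reading (wt k) P := fun k P => by
    rw [hσa]; exact (isSelfAdjoint_reading (wt k) P).star_eq
  obtain ⟨hΦdR, hΦbR, hrealR⟩ := vacSlice_clauses_of_potentialKPG (W := W) (E := E) (T := T) (Ψ := Ψ) (κ := κ) G hσ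
    hiso hfixρ hB hpbar hKP hdec hpin hΨv hexplZ hp₀
  have hss : ball (0 : lp (fun _ : ι => ℂ) ∞) s₀ ⊆ ball 0 R₀ := ball_subset_ball hsR.le
  have hlast := lastCouplingLipschitz_of_couplingTwoPoint_room_sharp2 G h0 hAdm hres hadd hloc hstep hfac hsmul hne hwt hτ hτbar
    hω hωh hωωh hs₀ hsR hB hpbar hθ1 hKP hkp2 hdec hpin hΨv hexplZ hp₀ hclip0 hCup hqT0 hTcup hroom
  have hϱ : 0 < R₀ - s₀ := sub_pos.mpr hsR; have hclipbar : 0 ≤ clipbar := (hclip0 0).trans (hclipb 0)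
  have hqTbar : 0 ≤ qTbar := (hqT0 0).trans (hqTb 0); have hc : 0 ≤ 2 * B / (R₀ - s₀) := by positivity
  have hℓ : 0 ≤ 2 * clipbar * B + 2 * B / (R₀ - s₀) * qTbar := by positivity
  have hlam : ∀ k, 2 * clip k * B + 2 * B / (R₀ - s₀) * qT k ≤ 2 * clipbar * B + 2 * B / (R₀ - s₀) * qTbar := fun k =>
    add_le_add (by gcongr; exact hclipb k) (mul_le_mul_of_nonneg_left (hqTb k) hc)
  exact ne9_and_fadingMemory_of_holoSlice_sharp_SP h0 hAdm hres hadd hloc hstep hfac hlast hsmul hne hwt hτ hτbar hω hωh hωωh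
    hs₀ (by positivity) hθ0 hθ1 hℓ (fun k g hg => (hΦdR k g hg).mono hss)
    (fun k g hg => (hΦbR k g hg).mono hss Subset.rfl) (fun k g hg s hs hmem => hrealR k g hg s hs (hss hmem)) hroom hlam

end Room

/-! ## §3 At the record's own new-term map `NE9EndApplied.ΨOf` (shape by `rfl`) -/

section Record

open Summit.QuantumFields.BalabanUV.T4Continuum.NE9EndApplied
open Summit.QuantumFields.BalabanUV.T4Continuum.NE9ComplexEncoding (doubleCarriers)

variable {C₀ : Carriers} {E : Type} {ι : Type}

omit G in
/-- **ROUTE R4♯'s END AT THE RECORD's OWN NEW-TERM MAP `ΨOf`, TABLE HALF ON `PotentialKPG`, COUPLING HALF AT `2·clip`** — §2 at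
`Ψ := NE9EndApplied.ΨOf G act wt U₀ explZ` (`hΨv` by `psiOf_eq_vac`, `rfl`): for ANY functional `Ef` on the re∕im-doubled carriers factorising
through a channel `T` with this new-term map (e.g. `EfOf …`, `factorises_EfOf`), `PotentialKPG` + `hkp2` + `hdec` + `hpin` + `hCup` + `hTcup` +
`hexplZ` + structural binders + ROOM ⇒ `NE9 Ef W κ (prodModuli ((1∕(1−θ²))·(2·clipbar·B + 2·B∕(R₀ − s₀)·qTbar)) (fun _ => θ)) ∧
FadingMemory …` — E131 §5's letters with the coupling summand `8 ↦ 2` and the pencil as `PotentialKPG` + `hkp2`.  The R4 counterpart of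
leaf-06's D2 ENDs `…_vacSub_sizeInduction_sharp1` (R3′ at the same coupling constant).  «NE9 ⇐ the named binders»; nothing of Bałaban's asserted.
[cite: Balaban1987RG1, (2.13)-(2.14) p.268 and (0.23) p.256; Balaban1988RG2Cluster, (1.33)-(1.36) p.9, (2.38) p.20, (2.40)-(2.41) p.21; FV1980, ch.V §5] -/
theorem ne9_and_fadingMemory_of_potentialKPG_coupling_psiOf_SP [Nonempty ι] (G : ClusterGeom (doubleCarriers C₀))
    {Ef : Functional (doubleCarriers C₀) E} {W : Set (ℕ → ℝ)} {Adm : Set (E → (doubleCarriers C₀).Dom → ℝ)}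
    {T : ℕ → (ℕ → ℝ) → (E → (doubleCarriers C₀).Dom → ℝ) → ι → ℝ} {κ : ℝ} {wt : ℕ → ι → ℝ} {τ : ℕ → ℕ → ℝ}
    {τbar ω ωh : ℝ} {act : ℕ → ℝ → E → lp (fun _ : ι => ℂ) ∞ → G.P → ℂ} {U₀ : E}
    {explZ : ℕ → E → (doubleCarriers C₀).Dom → ℝ}
    (h0 : ∀ g ∈ W, ∀ (U : E) (X : (doubleCarriers C₀).Dom), (doubleCarriers C₀).scale X = 0 → Ef g U X = 0)
    (hAdm : AdmissibleTerms Ef W Adm) (hres : AdmRestrict Adm) (hadd : ChannelAdditive Adm T) (hloc : ChannelLocal Adm T)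
    (hstep : ChannelSizeAtStepNN Adm T κ wt τ) (hfac : Factorises Ef W T (ΨOf G act wt U₀ explZ))
    (hsmul : ∀ (c : ℝ), ∀ H ∈ Adm, c • H ∈ Adm) (hne : Adm.Nonempty) (hwt : ∀ m y, 0 < wt m y)
    (hτ : ∀ k j, j ≤ k → 0 ≤ τ k j ∧ τ k j ≤ τbar * ω ^ (k - j)) (hτbar : 0 < τbar) (hω : 0 ≤ ω) (hωh : 0 < ωh)
    (hωωh : ω ≤ ωh) {m : ℕ → ℝ → E → G.P → ℝ} {a d : G.P → ℝ} {δ : (doubleCarriers C₀).Dom → ℝ}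
    {p₀ clip qT : ℕ → ℝ} {R₀ s₀ B pbar θ clipbar qTbar : ℝ}
    (hs₀ : 0 < s₀) (hsR : s₀ < R₀) (hB : 0 ≤ B) (hpbar : 0 ≤ pbar) (hθ0 : 0 < θ) (hθ1 : θ < 1)
    (hKP : G.PotentialKPG W act m a d R₀)
    (hkp2 : ∀ g ∈ W, ∀ (k : ℕ) (U : E) (X : (doubleCarriers C₀).Dom), (doubleCarriers C₀).scale X = k + 1 →
      ∀ γ ∈ G.vol X, ∑ γ' ∈ G.vol X with G.inc γ' γ, 2 * m k (g k) U γ' * Real.exp (a γ' + d γ') ≤ a γ)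
    (hdec : G.DecayExtract δ d) (hpin : G.PinBudget a δ (fun _ => B) κ)
    (hexplZ : ∀ (k : ℕ) (U : E) (X : (doubleCarriers C₀).Dom), (doubleCarriers C₀).scale X = k + 1 →
      |explZ k U X| ≤ Real.exp (-(κ * (doubleCarriers C₀).d X)) * p₀ k)
    (hp₀ : ∀ k, p₀ k ≤ pbar) (hclip0 : ∀ k, 0 ≤ clip k) (hclipb : ∀ k, clip k ≤ clipbar)
    (hCup : ∀ g ∈ W, ∀ g' ∈ W, ∀ (k : ℕ) (U : E) (X : (doubleCarriers C₀).Dom), (doubleCarriers C₀).scale X = k + 1 →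
      ∀ Q ∈ ball (0 : lp (fun _ : ι => ℂ) ∞) s₀, ∀ γ ∈ G.vol X,
        ‖act k (g k) U Q γ‖ ≤ m k (g' k) U γ ∧
          ‖act k (g k) U Q γ - act k (g' k) U Q γ‖ ≤ clip k * |g k - g' k| * m k (g' k) U γ)
    (hqT0 : ∀ k, 0 ≤ qT k) (hqTb : ∀ k, qT k ≤ qTbar)
    (hTcup : ∀ g ∈ W, ∀ g' ∈ W, ∀ (k : ℕ) (y : ι),
      |T k g (Ef g) y - T k g' (Ef g) y| ≤ wt k y * (qT k * |g k - g' k|))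
    (hroom : ωh * s₀ + τbar * (2 * B + pbar) ≤ θ * s₀) :
    NE9 Ef W κ (prodModuli (1 / (1 - θ ^ 2) * (2 * clipbar * B + 2 * B / (R₀ - s₀) * qTbar)) fun _ => θ) ∧
      FadingMemory (1 / (1 - θ ^ 2) * (2 * clipbar * B + 2 * B / (R₀ - s₀) * qTbar) / θ) θ
        (prodModuli (1 / (1 - θ ^ 2) * (2 * clipbar * B + 2 * B / (R₀ - s₀) * qTbar)) fun _ => θ) :=
  ne9_and_fadingMemory_of_potentialKPG_coupling_SP_vac G h0 hAdm hres hadd hloc hstep hfac hsmul hne hwt hτ hτbar hω hωh hωωh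
    hs₀ hsR hB hpbar hθ0 hθ1 hKP hkp2 hdec hpin (fun k s Q U X => psiOf_eq_vac G act wt U₀ explZ k s Q U X) hexplZ hp₀ hclip0
    hclipb hCup hqT0 hqTb hTcup hroom

end Record

end Summit.QuantumFields.BalabanUV.T4Continuum.NE9HoloFamilyCoupledEndSharp2

end
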